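import Summits.BirchSwinnertonDyer.BirchSwinnertonDyer.Theorems.RamifiedHeegnerPairLeafRankOneUpperAtThreeShimuraInertComposition
import HarnessLib

/-!
# Route `RamifiedHeegnerPair`, crux U₁ `LeafRankOneUpperAtThree` (stmt-BirchSwinnertonDyer-26022), line `splitkolyvagin` —
# the INERT-CARRIER (Shimura-curve) road, part 7: the core with the Heegner datum ASKED AT THE DATUM, and its second source —
# the bsd-stepL KERNEL Kolyvagin bound from the printed Heegner-system primitives on the `ρ̄₃`-ONTO rows (no JSW flag)

HONEST FRAMING. Theorems only; helper file (`--supports stmt-BirchSwinnertonDyer-26022 --as helper`); nothing is booked, no item is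
closed, BSD is not proved for any curve; CONDITIONAL on every displayed input. Lead prover bsd-line-rhp-p2 g10, 2026-08-28.

WHY. Parts 2–6 take the Shimura-curve input as the ONE named fact `shimuraCurve_heegnerPoint_grossZagier_kolyvagin`, whose Kolyvagin
conjunct at `3 ∣ N⁺` is JSW 2017 Thm. 4.4.1 AS PRINTED (reading flag `JSW17-Thm441-Nekovar-primary`). Cell bsd-stepL (seat shim-p2,
crux 19899 of `ClassRecordThree`/`KolyvaginRoadThree`) PROVED that order bound IN THE KERNEL at `p = 3 ∣ N` for curves with `ρ̄₃` ONTO,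
from Poitou–Tate, GZK, modularity, the Cassels–Tate level inputs and the printed Heegner-system primitives of `X_{N⁺,N⁻}`
(`Theorems/ClassRecordThreeShimuraKolyvaginOrderBoundAtThreeSurjOfNamedPrimitivesAtThree.lean`,
`ShimuraKolyvaginSurjNamedPrimitivesAtThree.shimuraKolyvaginOrderBoundAtThreeSurj_of_…`) — its statement carries NO reduction
condition at `3` (the leaf's additive `3 ∣ N⁺` is inside it; the primitives fact is typed without one either, its printed relations
(B1)–(B5) living at Kolyvagin primes `ℓ ∤ N`). Census: 105 of the 116 Shimura rows (rank-one Gss2, `N < 5·10⁵`) are `ρ̄₃`-onto.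

* §9 `leafRankOneUpper_three_of_shimuraInertDatum_at` — part 2's core with the Heegner point / display / order bound asked AT THE DATUM
  (universal in the class-minimal Shimura datum only).
* part 8 (`…ShimuraInertPrimitives.lean`): the two sources (`shimuraHeegnerAt_of_fact`, `shimuraHeegnerAt_of_primitives_of_surj`) and
  the quotable two-carrier form on the ONTO rows with every input a PRINTED THEOREM taken by name (+ L₀).

References: [cite: McCallumLMS1991, §1 Theorem (Kolyvagin)] [cite: GrossLMS1991, §§3–5] [cite: CaiShuTian2014, Thm. 1.5]
[cite: JetchevSkinnerWan2017, §7.4.2 (p. 31), Thm. 4.4.1 (p. 19)] [cite: PastenShimura2024, Prop. 6.13, Lemmas 6.14–6.16, 6.18]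
[cite: BertoliniDarmon1996, §2] [cite: FriedbergHoffstein1995, Thm. B] [cite: Miller2011LMS, Def. 1.1].
-/

-- D-0017: single-problem summit, so `Summit.BirchSwinnertonDyer.BirchSwinnertonDyer.…` repeats a namespace BY DESIGN.
set_option linter.dupNamespace false
set_option autoImplicit false

noncomputable section

open scoped Classical NumberField

open WeierstrassCurve NumberField IsDedekindDomain Literature Literature.NumberTheory.EllipticCurves
  Rat.HeightOneSpectrum CongruenceSubgroup
  Literature.NumberTheory.EllipticCurves.ModularForms
  Literature.NumberTheory.EllipticCurves.Rank1Residual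
  Literature.NumberTheory.EllipticCurves.Rank1Residual.Typed
  Literature.NumberTheory.QuadraticFields.Quadratic
  Literature.NumberTheory.GaloisCohomology
  Literature.NumberTheory.Automorphic
  Summit.BirchSwinnertonDyer.Rank1Residual
  Summit.BirchSwinnertonDyer.Rank1Residual.Additive
  Summit.BirchSwinnertonDyer.Rank1Residual.X11b
  Summit.BirchSwinnertonDyer.Rank1Residual.X11b.Three
  Summit.BirchSwinnertonDyer.BirchSwinnertonDyer.Theses.RamifiedHeegnerPair
  Summit.BirchSwinnertonDyer.BirchSwinnertonDyer.Theorems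

namespace Summit.BirchSwinnertonDyer.BirchSwinnertonDyer.Theorems.LeafShimuraInert

/-! ## §9 The core with the Heegner datum asked at the datum -/

/-- **U₁ AT A LEAF CURVE FROM ONE JETCHEV–SKINNER–WAN DATUM — core′: the Shimura-curve Heegner point, its display and its
Kolyvagin bound asked AT THE DATUM (any source).** Part 2's `leafRankOneUpper_three_of_shimuraInertDatum` VERBATIM except that the
∀-fact `shimuraCurve_heegnerPoint_grossZagier_kolyvagin` is replaced by its ∃-body AT `(W, 3, N_W, K, S, Dt)`, universal only in the
class-minimal Shimura datum `(X, W′, P₀)` (`hHKat`): the point `P ∈ E(K)`, a degree `degS > 0` with `ord₃ degS = ord₃ deg P₀`, the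
Cai–Shu–Tian display, and the order bound `#Ш(E/K)[3^∞] ≤ 3^{2·ord₃[E(K):ℤP]}` for non-torsion `P`. Two sources instantiate it (part 8):
the named fact itself (JSW 2017 Thm. 4.4.1 AS PRINTED, flag `JSW17-Thm441-Nekovar-primary`), or — on the `ρ̄₃`-ONTO rows — the bsd-stepL
KERNEL Kolyvagin argument from the printed Heegner-system primitives (`shimuraCurve_heegnerSystem_primitivesAtThree`, Cassels–Tate level
inputs, Poitou–Tate), which carries no such flag. CONCLUSION: `Typed.MissingUpperBoundAt W 3`. CONDITIONAL; nothing booked.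
-- adapted from Summits/BirchSwinnertonDyer/BirchSwinnertonDyer/Theorems/RamifiedHeegnerPairLeafRankOneUpperAtThreeShimuraInert.lean
[cite: JetchevSkinnerWan2017, §7.4.2 (pp. 30–31) and Thm. 4.4.1 (p. 19)] [cite: CaiShuTian2014, Thm. 1.5]
[cite: PastenShimura2024, Prop. 6.13, Lemmas 6.8, 6.14–6.16, 6.18 (pp. 22–25)] [cite: PapikianRabinoff2016, Cor. 3.5]
[cite: McCallumLMS1991, §1 Theorem (Kolyvagin)] [cite: Miller2011LMS, Def. 1.1] -/
theorem leafRankOneUpper_three_of_shimuraInertDatum_at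
    -- published inputs (named facts of the tree)
    (hGZK : rank_eq_analyticRank_of_analyticRank_le_one) (hmod : hasEntireLFunction_rat)
    (hnf : exists_isNewformOf) (hJL : nonempty_shimuraParametrizationData)
    (hCO : PastenShimura2024_componentOrders)
    -- the leaf curve, with a datum whose constant is a `3`-unit
    (W : WeierstrassCurve ℚ) [W.IsElliptic] [W.IsGloballyMinimal]
    (hadd : Addv W 3) (hsub : SubGss W 3) (hr : W.analyticRank = 1)
    {N : ℕ} [NeZero N] (hN : W.conductorNorm ℤ = N)
    (Dt : ModularParametrizationData W N) (hc : ¬ (3 : ℤ) ∣ Dt.c)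
    -- the inert set: even, multiplicative, every split-multiplicative carrier inside
    (S : Finset ℕ) (hSeven : Even S.card)
    (hSmult : ∀ ℓ ∈ S, ∃ _ : Fact ℓ.Prime, W.HasMultiplicativeReductionAtPrime ℓ)
    (hFC : ∀ (ℓ : ℕ) [Fact ℓ.Prime], ℓ ∉ S → W.HasSplitMultiplicativeReductionAtPrime ℓ →
      ¬ 3 ∣ padicValInt ℓ W.minimalDiscriminantInt)
    -- SHAPE: every Tamagawa-`3` carrier is split multiplicative
    (hshape : ∀ (q : ℕ) [Fact q.Prime], 3 ∣ (W.baseChange ℚ_[q]).localTamagawaNumber ℤ_[q] →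
      W.HasSplitMultiplicativeReductionAtPrime q)
    -- (DEG)-availability: Pasten Lemma 6.15 | Lemma 6.16 | Lemma 6.18 (Papikian–Rabinoff)
    (hDEG : (∃ ℓ₀ ∈ S, ¬ 3 ∣ padicValInt ℓ₀ W.minimalDiscriminantInt) ∨
      (∃ ℓ₀ t : ℕ, ∃ _ : Fact ℓ₀.Prime, ∃ _ : Fact t.Prime,
        W.HasMultiplicativeReductionAtPrime ℓ₀ ∧ W.HasMultiplicativeReductionAtPrime t ∧
        ℓ₀ ∉ S ∧ t ∉ S ∧ t ≠ ℓ₀ ∧ ¬ 3 ∣ padicValInt ℓ₀ W.minimalDiscriminantInt) ∨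
      (∃ q₁ q₂ : ℕ, S = {q₁, q₂} ∧ q₁ ≠ q₂ ∧ q₂ ≠ 2 ∧ q₂ % 3 ≠ 1))
    -- ONE Jetchev–Skinner–Wan field datum, `d_K` odd
    (K : Type) [Field K] [NumberField K] (hK : IsImaginaryQuadratic K) (hodd : Odd (NumberField.discr K))
    (hinert : ∀ ℓ ∈ S, ((Ideal.span {(ℓ : ℤ)}).primesOver (𝓞 K)).ncard = 1 ∧ ¬ (ℓ : ℤ) ∣ NumberField.discr K)
    (hsplitN : ∀ ℓ : ℕ, ℓ.Prime → ℓ ∣ W.conductorNorm ℤ → ℓ ∉ S →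
      ((Ideal.span {(ℓ : ℤ)}).primesOver (𝓞 K)).ncard = 2)
    (hLt : (W.quadraticTwist (NumberField.discr K : ℚ)).entireLFunction 1 ≠ 0)
    -- the Shimura-curve Heegner point, display and order bound AT THE DATUM (any source, part 8)
    (hHKat : ∀ (X : ShimuraCurveData (∏ q ∈ S, q) (N / ∏ q ∈ S, q)) (W' : WeierstrassCurve ℚ) [W'.IsElliptic]
      (P₀ : ShimuraParametrizationData X W'), P₀.IsMinimalFor W →
      ∃ (P : (W.baseChange K).toAffine.Point) (degS : ℕ), 0 < degS ∧
        padicValNat 3 degS = padicValNat 3 P₀.deg ∧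
        LDerivEK W K =
          8 * (Real.pi : ℂ) ^ 2 * peterssonProduct (Gamma0 N) 2 Dt.f Dt.f /
              ((((Units.torsionOrder K : ℝ) / 2) ^ 2 * √|(NumberField.discr K : ℝ)| : ℝ) : ℂ) *
            ((P.canonicalHeight : ℂ) / (degS : ℂ)) ∧
        (¬ IsOfFinAddOrder P →
          Nat.card (AddCommGroup.primaryComponent (W.baseChange K).sha 3) ≤
            3 ^ (2 * padicValNat 3 (AddSubgroup.zmultiples P).index)))
    -- the partner's LOWER half at this field
    (hPL : ∀ (Wd : WeierstrassCurve ℚ) [Wd.IsElliptic] [Wd.IsGloballyMinimal] (Cd : VariableChange ℚ),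
      Cd • W.quadraticTwist (NumberField.discr K : ℚ) = Wd → Typed.MissingLowerBoundAt Wd 3) :
    Typed.MissingUpperBoundAt W 3 := by
  subst hN
  haveI h3F : Fact (Nat.Prime 3) := ⟨Nat.prime_three⟩
  have hNS : integral_neronScaling_of_isGloballyMinimal :=
    integral_neronScaling_of_isGloballyMinimal_holds
  have hp : (3 : ℕ).Prime := Nat.prime_three
  have hp2 : (3 : ℕ) ≠ 2 := by decide
  have hirr : W.HasIrreducibleModPGaloisRep 3 := Additive.irr_of_subGss_of_ne_two W 3 hp2 hadd hsub
  have hbad3 : ¬ W.HasGoodReductionAtPrime 3 := not_good_of_addv W 3 hadd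
  have hnm3 : ¬ W.HasMultiplicativeReductionAtPrime 3 := not_mult_of_addv W 3 hadd
  -- the sign of the functional equation is `−1` (modularity, `r_an = 1`)
  have hw : W.rootNumber = -1 := by
    rw [WeierstrassCurve.rootNumber_eq_neg_one_pow_analyticRank_of_exists_isNewformOf hnf W, hr]
    norm_num
  have hN0 : W.conductorNorm ℤ ≠ 0 := (W.conductorNorm_pos_holds).ne'
  haveI : NeZero (W.conductorNorm ℤ) := ⟨hN0⟩
  have hNpos : 0 < W.conductorNorm ℤ := W.conductorNorm_pos_holds
  -- the set of multiplicative primes and the Pasten package with (P618)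
  set Mlt : Finset ℕ := (W.conductorNorm ℤ).primeFactors.filter
    (fun q ↦ ∃ h : q.Prime, @WeierstrassCurve.HasMultiplicativeReductionAtPrime W q ⟨h⟩) with hMlt
  have hmemMlt : ∀ {q : ℕ} [hq : Fact q.Prime], W.HasMultiplicativeReductionAtPrime q → q ∈ Mlt := by
    intro q hq hm
    have hqN : q ∣ W.conductorNorm ℤ :=
      (W.dvd_conductorNorm_iff_not_hasGoodReductionAtPrime q).mpr
        (WeierstrassCurve.HasMultiplicativeReduction.not_hasGoodReduction (R := ℤ_[q]) hm)
    exact Finset.mem_filter.mpr ⟨Nat.mem_primeFactors.mpr ⟨hq.out, hqN, hN0⟩, hq.out, hm⟩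
  have hMlt_exact : ∀ q ∈ Mlt, q.Prime ∧ q ∣ W.conductorNorm ℤ ∧ ¬ q ^ 2 ∣ W.conductorNorm ℤ := by
    intro q hq
    obtain ⟨hqN, hqp, hm⟩ := Finset.mem_filter.mp hq
    haveI : Fact q.Prime := ⟨hqp⟩
    exact ⟨hqp, (Nat.mem_primeFactors.mp hqN).2.1, not_sq_dvd_conductorNorm_of_mult W q hm⟩
  -- the optimal classical datum of the class (Modularity) and the Pasten package (named facts)
  obtain ⟨W₀, hW₀, hW₀m, D₀, hfW, hisoW, hmin⟩ :=
    exists_optimal_modularParametrizationData_of_modularity hnf (W.conductorNorm ℤ) W rfl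
  obtain ⟨δ, cA, ι, κ, hδ0, hδ, hcA, hanchor, h613, hij, h68, hEis, h618⟩ :=
    ribetTakahashiPackageCoker_of_componentOrders hCO PastenShimura2024_lemma_6_8_isogeny_holds hJL W 3 hirr
      (W.conductorNorm ℤ) W₀ D₀ rfl hfW hmin
  obtain ⟨hvA, hι⟩ := rtPackage_valuation_forms W 3 hirr hcA h68 hEis
  -- the inert set sits inside the multiplicative primes and avoids `3`
  have hSMlt : S ⊆ Mlt := by
    intro ℓ hℓ
    obtain ⟨hℓF, hm⟩ := hSmult ℓ hℓ
    exact @hmemMlt ℓ hℓF hm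
  have hpS : 3 ∉ S := by
    intro h
    obtain ⟨_, hm⟩ := hSmult 3 h
    exact hnm3 hm
  -- (DEG) from one of the three printed mechanisms
  have hdeg : padicValNat 3 (δ ∅) =
      padicValNat 3 (δ S) + ∑ x ∈ S, padicValNat 3 (padicValInt x W.minimalDiscriminantInt) := by
    rcases hDEG with ⟨ℓ₀, hℓ₀S, hram₀⟩ | ⟨ℓ₀, t, hℓ₀F, htF, hm₀, hmt, hℓ₀S, htS, htℓ, hram₀⟩ |
        ⟨q₁, q₂, hSeq, hne, hq₂2, hq₂1⟩
    · obtain ⟨n, hn⟩ := hSeven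
      exact RTDegree.padicValNat_delta_empty_eq_of_witness_mem h613 hδ hcA hij hvA hι
        (padicValNat.eq_zero_of_not_dvd hram₀) n S hSMlt (by omega) (Or.inr hℓ₀S)
    · haveI := hℓ₀F; haveI := htF
      exact RTDegree.padicValNat_delta_empty_eq_of_witness h613 hδ hcA hij hvA hι hSMlt hSeven
        (hmemMlt hm₀) (padicValNat.eq_zero_of_not_dvd hram₀) (hmemMlt hmt) htS htℓ
    · have hq₁ : q₁ ∈ Mlt := hSMlt (by rw [hSeq]; simp)
      have hq₂ : q₂ ∈ Mlt := hSMlt (by rw [hSeq]; simp)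
      have h31 : ¬ 3 ∣ q₂ - 1 := by
        intro h
        have hq₂p : q₂.Prime := (hMlt_exact q₂ hq₂).1
        have h2le : 2 ≤ q₂ := hq₂p.two_le
        omega
      have h := padicValNat_delta_empty_eq_of_pair_coker (c := fun x ↦ padicValInt x W.minimalDiscriminantInt)
        h613 hδ hcA hij hvA hι h618 hq₁ hq₂ hne hq₂2 h31
      have hSeq' : S = insert q₁ (insert q₂ ∅) := by rw [hSeq]; rfl
      rw [hSeq']
      exact h
  -- field data
  have h2 := hK.1
  have hd4 : NumberField.discr K % 4 = 1 := discr_emod_four_eq_one hK.1 hodd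
  have h3N : 3 ∣ W.conductorNorm ℤ := (W.dvd_conductorNorm_iff_not_hasGoodReductionAtPrime 3).mpr hbad3
  have hps2 : ((Ideal.span {((3 : ℕ) : ℤ)}).primesOver (𝓞 K)).ncard = 2 := hsplitN 3 hp h3N hpS
  have hps : SplitsIn K 3 := hps2
  have hH3 : SatisfiesHeegnerHypothesis 3 K := fun q hq hq3 ↦ by
    have : q = 3 := (Nat.prime_dvd_prime_iff_eq hq hp).mp hq3
    subst this; exact hps2
  have hpd : ¬ ((3 : ℕ) : ℤ) ∣ NumberField.discr K := not_dvd_discr_of_splitsIn h2 hp hps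
  -- `d_K < -4` (odd, `≠ -3`), so `w_K = 2` is prime to `3`
  have hμ : ¬ 3 ∣ Units.torsionOrder K := by
    haveI : IsTotallyComplex K := hK.2
    have hneg : NumberField.discr K < 0 := discr_neg_of_finrank_eq_two K hK.1
    have h3d : NumberField.discr K ≠ -3 := by
      intro h; apply hpd; rw [h]; norm_num
    have h4 : NumberField.discr K < -4 := by omega
    rw [Literature.NumberTheory.DiophantineGeometry.torsionOrder_eq_two_of_discr_lt hK.1 h4]
    decide
  have hSin : ∀ ℓ ∈ S, ∃ _ : Fact ℓ.Prime, Mult W ℓ ∧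
      ((ℓ ≠ 2 ∧ jacobiSym (NumberField.discr K) ℓ = -1) ∨ (ℓ = 2 ∧ NumberField.discr K % 8 = 5)) := by
    intro ℓ hℓ
    obtain ⟨hℓF, hm⟩ := hSmult ℓ hℓ
    obtain ⟨hn, hd⟩ := hinert ℓ hℓ
    refine ⟨hℓF, hm, ?_⟩
    have hn' : ((Ideal.span {(ℓ : ℤ)}).primesOver (𝓞 K)).ncard ≠ 2 := by rw [hn]; decide
    by_cases hℓ2 : ℓ = 2
    · subst hℓ2
      have hn2 : ((Ideal.span {(2 : ℤ)}).primesOver (𝓞 K)).ncard ≠ 2 := by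
        simpa only [Nat.cast_ofNat] using hn'
      have hd2 : ¬ (2 : ℤ) ∣ NumberField.discr K := by simpa only [Nat.cast_ofNat] using hd
      exact Or.inr ⟨rfl, discr_emod_eight_eq_five_of_ncard_ne_two h2 hn2 hd2⟩
    · exact Or.inl ⟨hℓ2, jacobiSym_discr_eq_neg_one_of_ncard_ne_two h2 hℓF.out hℓ2 hn' hd⟩
  have hsplit : ∀ (ℓ : ℕ) [Fact ℓ.Prime], ¬ W.HasGoodReductionAtPrime ℓ → ℓ ∉ S →
      IsSquare (algebraMap ℚ ℚ_[ℓ] (NumberField.discr K : ℚ)) := by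
    intro ℓ hℓF hg hℓS
    have hℓN : ℓ ∣ W.conductorNorm ℤ := (W.dvd_conductorNorm_iff_not_hasGoodReductionAtPrime ℓ).mpr hg
    exact isSquare_discr_padic_of_ncard_eq_two h2 ℓ (hsplitN ℓ hℓF.out hℓN hℓS)
  -- `d_K` odd: the ramified primes of `K` are good primes `≥ 5` (`2 ∤ d_K`, `3 ∤ d_K`)
  have hdodd : ¬ (2 : ℤ) ∣ NumberField.discr K := by
    obtain ⟨k, hk⟩ := hodd
    omega
  have h5 : ∀ (q : ℕ) [Fact q.Prime], (q : ℤ) ∣ NumberField.discr K → W.HasGoodReductionAtPrime q →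
      5 ≤ q ∨ 5 ≤ 3 := by
    intro q hqF hqd _
    have hq : q.Prime := hqF.out
    have hq2 : q ≠ 2 := by
      rintro rfl
      exact hdodd (by exact_mod_cast hqd)
    have hq3 : q ≠ 3 := by
      rintro rfl
      exact hpd hqd
    exact Or.inl (hq.five_le_of_ne_two_of_ne_three hq2 hq3)
  -- a globally minimal model of the twist, differing from the twisted equation by a `3`-unit; it is a rank-zero LEAF curve
  have hD0 : (NumberField.discr K : ℚ) ≠ 0 := by exact_mod_cast NumberField.discr_ne_zero K
  haveI hEt : (W.quadraticTwist (NumberField.discr K : ℚ)).IsElliptic :=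
    W.isElliptic_quadraticTwist hD0
  obtain ⟨Cd, hCd⟩ := hasGlobalMinimalModel_rat_holds (W.quadraticTwist (NumberField.discr K : ℚ))
  haveI : (Cd • W.quadraticTwist (NumberField.discr K : ℚ)).IsGloballyMinimal := hCd
  set Wd : WeierstrassCurve ℚ := Cd • W.quadraticTwist (NumberField.discr K : ℚ) with hWd_def
  have hWd : Cd • W.quadraticTwist (NumberField.discr K : ℚ) = Wd := rfl
  have hu : padicValRat 3 (Cd.u : ℚ) = 0 :=
    padicValRat_u_eq_zero_of_twist_minimal_of_splitsIn W 3 K h2 hps Cd hWd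
  -- torsion: `3 ∤ #E(ℚ)_tors`, `3 ∤ #E^{d}(ℚ)_tors`
  have htW : ¬ 3 ∣ W.torsionOrder := not_dvd_torsionOrder_of_irr W 3 hirr
  have hirrd : Wd.HasIrreducibleModPGaloisRep 3 :=
    hasIrreducibleModPGaloisRep_twist_model W 3 K h2 hirr Cd hWd
  have htd : ¬ 3 ∣ Wd.torsionOrder := not_dvd_torsionOrder_of_irr Wd 3 hirrd
  -- the rank-0 twist's algebraic central value (modular symbols) and its analytic rank
  have hmodP : nonempty_modularParametrizationData :=
    nonempty_modularParametrizationData_iff_exists_isNewformOf_unconditional.mpr hnf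
  obtain ⟨qd, hqd⟩ :=
    Summit.BirchSwinnertonDyer.Rank1Residual.X1.RankZeroPartner.exists_rat_entireLFunction_one_div_realPeriodRat
      hmodP Wd
  have hLt' : (W.quadraticTwist (NumberField.discr K : ℚ)).entireLFunction = Wd.entireLFunction := by
    rw [← hWd, entireLFunction_smul]
  have hLd1 : Wd.entireLFunction 1 ≠ 0 := by rw [← hLt']; exact hLt
  have hrd : Wd.analyticRank = 0 := (Wd.analyticRank_eq_zero_iff_holds (hmod Wd)).2 hLd1
  have hfinSd : Wd.ShaFinite := (hGZK Wd (by rw [hrd]; omega)).2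
  have hfinW : W.ShaFinite := (hGZK W (by omega)).2
  ---------------------------------------------------------------- the Shimura curve `X_{N⁺,N⁻}`, `N⁻ = ∏ S`, and its class-minimal datum
  obtain ⟨X, W', hW', P₀, hP₀, hdegδ⟩ := hanchor hSMlt hSeven
  haveI := hW'
  ---------------------------------------------------------------- the Heegner point of `X_{N⁺,N⁻}` at `K` (named fact)
  obtain ⟨P, degS, hdegS, hlinkS, hGZP, hUShP⟩ := hHKat X W' P₀ hP₀
  -- the two degree links
  have hlink₁ : padicValNat 3 Dt.modularDegree = padicValNat 3 (δ ∅) := by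
    rw [hδ0]; exact padicValNat_modularDegree_eq_of_isNewformOf hNS hisoW D₀ hfW hmin hp hirr Dt hc
  have hlink₂ : padicValNat 3 degS = padicValNat 3 (δ S) := by rw [hlinkS, hdegδ]
  ---------------------------------------------------------------- covolume form (Zagier) and (U-Sh) (non-torsion)
  have hGZR := degS_mul_lDerivEK_eq_of_petersson W (W.conductorNorm ℤ) K Dt P hdegS hGZP
  have hUSh : Nat.card (AddCommGroup.primaryComponent (W.baseChange K).sha 3) ≤
      3 ^ (2 * padicValNat 3 (AddSubgroup.zmultiples P).index) :=
    hUShP (not_isOfFinAddOrder_of_petersson_display hmod W K hr hLt P _ _ hGZP)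
  -- (GZ-Sh₀) from (GZ-Sh-ℝ), then the links
  obtain ⟨qE, hqE, hqd0, hE, h0⟩ := gzShape₀_of_shimuraGZReal W 3 (W.conductorNorm ℤ) K Dt P degS
    hGZK hmod hK hp2 hc hμ hr hLt hdegS hGZR Wd Cd hWd hu qd hqd htW htd
  have h₀ : (2 * padicValNat 3 (AddSubgroup.zmultiples P).index : ℤ) + padicValNat 3 (δ ∅) =
      padicValRat 3 qE + padicValRat 3 qd + padicValNat 3 (δ S) := by
    rw [← hlink₁, ← hlink₂]; exact h0
  -- (GZ-Sh) = (GZ-Sh₀) + (DEG)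
  have hGZSh : ∃ qE qd : ℚ, qE ≠ 0 ∧ qd ≠ 0 ∧
      W.leadingLCoeff / ((W.realPeriodRat : ℂ) * (W.regulator : ℂ)) = (qE : ℂ) ∧
      Wd.entireLFunction 1 / (Wd.realPeriodRat : ℂ) = (qd : ℂ) ∧
      (2 * padicValNat 3 (AddSubgroup.zmultiples P).index : ℤ) +
          (∑ ℓ ∈ S, padicValNat 3 (padicValInt ℓ W.minimalDiscriminantInt) : ℕ) =
        padicValRat 3 qE + padicValRat 3 qd :=
    ⟨qE, qd, hqE, hqd0, hE, hqd, gzShape_of_gzShape₀_of_deg h₀ hdeg⟩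
  ---------------------------------------------------------------- the numeric Tamagawa condition and the partner's lower half
  have hT := padicValNat_tamagawaProduct_add_twist_le_of_inertSet'_odd W 3 hp2 K h2 hdodd h5 hshape Cd hWd S
    hSin (fun ℓ _ hg hℓS ↦ hsplit ℓ hg hℓS) (fun ℓ _ hℓS hs ↦ hFC ℓ hℓS hs)
  have htw := twistLowerShape_of_missingLowerBoundAt_rankZero hGZK Wd hrd hqd0 hqd (hPL Wd Cd hWd)
  exact missingUpperBoundAt_of_shimuraShapes W 3 hp2 K h2 Wd ⟨Cd, hWd⟩ hfinW hfinSd P _ hT htw hGZSh hUSh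



end Summit.BirchSwinnertonDyer.BirchSwinnertonDyer.Theorems.LeafShimuraInert

end
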